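import Summits.SmoothPoincare4.SmoothPoincare4.Theorems.ConvexBisectionAcyclicBisectionExistsHgapTwistRows
import HarnessLib

/-!
# Hgap ▸ part B, transfer step (R6c), tube side I: the attaching-tube chart in three real variables
# and its columns at the core
(wave 7, crux stmt-SmoothPoincare4-10508, line `modp-braid-orbits`, stub `stub_T3_dualPresentation` (T3)
▸ HB = `helper_Hgap_twisting` ▸ (R6c); registered sub-goal `helper_attachChart_columns`)

The tube-side map of the transfer `σ̂ = -s₀ ε` (`G2-REPORT.md` §4 (R6b), (R6c)) is `η̂ = f♭ ∘ flip` with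
`f♭ = (h j).boundaryTube` the ATTACHING tube.  This file studies the attaching tube as a map of three
real variables `q = (m'₀, m'₁, ψ)`,

  `F (q) := ((f♭ (e^{2πiψ}, (m'₀, m'₁))).1).1 = (f (depthLine (circlePt ψ) m' 0)).1 ∈ ℝ⁴`,

exactly in the shape of G2's belt-tube chart (`…HgapTwistChart3.lean`: fibre part `L q = (q₀, q₁)`,
angle `q 2`):

* §1 `F` is smooth on the chart domain `‖L q‖ < 1` (`contMDiffAt_attachChart`, `contDiffAt_attachChart`);
* §2 its value and its three columns at a core point `q₀ = (0, 0, t)`: `F q₀ = K(t)`, `∂₂F = K'(t)` (the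
  ambient velocity of the attaching circle), `∂₀F = D e₀`, `∂₁F = D e₁` with `D` the fibre derivative of the
  attaching tube `v ↦ (f (depthLine (e^{2πit}) v 0)).1` at `0` (`fderiv_attachChart_single_two/zero/one`,
  packaged as the registered `helper_attachChart_columns`).

The companion file `…HgapCharTubeCore.lean` computes `det4 (∇rho, D e₀, D e₁, K')` at the core through Z4's
page tube (sign `= ε`, the frame sign of the transition matrix); the sequels transport this sign to nearby
points (continuity) and through the polar flip (`det D(flip) = -1`) to H1's tube-side character `χ_η`.
Everything is proved; no named facts, no `sorry`.  References: A. A. Kosinski, *Differential Manifolds*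
(1993), III (3.1), VI §6 [Kosinski1993].
-/

noncomputable section

set_option linter.dupNamespace false

open scoped Manifold ContDiff Topology RealInnerProductSpace
open Set Function Metric Filter Complex

namespace Summit.SmoothPoincare4.SmoothPoincare4.Theorems.AcyclicBisectionExists.ModpBraidOrbits

open Literature.Topology.FourManifolds Literature.Topology.FourManifolds.LefschetzBase
  Literature.Topology.FourManifolds.HandleAttachingMap Literature.Geometry.Symplectic

variable {g : ℕ}

/-! ## §1 The attaching-tube chart `F (q) = f♭ (e^{2πi q₂}, (q₀, q₁))` read in `ℝ⁴` -/

section Chart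

variable (f : HandleAttachingMap 3 2 (Base g)) {L : EuclideanSpace ℝ (Fin 3) →L[ℝ] EuclideanSpace ℝ (Fin 2)}

/-- **The attaching-tube chart is smooth on the chart domain `‖L q‖ < 1`** (the tube is smooth on its
source, the source map `q ↦ (e^{2πi q₂}, L q)` is smooth). [cite: Kosinski1993, VI §6] -/
theorem contMDiffAt_attachChart (q : EuclideanSpace ℝ (Fin 3)) (hq : ‖L q‖ < 1) :
    ContMDiffAt 𝓘(ℝ, EuclideanSpace ℝ (Fin 3)) 𝓘(ℝ, EuclideanSpace ℝ (Fin 4)) ∞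
      (fun q : EuclideanSpace ℝ (Fin 3) => (((f.boundaryTube.toHomeo (circlePt (q 2), L q)).1).1 :
        EuclideanSpace ℝ (Fin 4))) q := by
  have hsrc : ((circlePt (q 2), L q) : (sphere (0 : EuclideanSpace ℝ (Fin 2)) 1) × EuclideanSpace ℝ (Fin 2)) ∈
      f.boundaryTube.toHomeo.source := by
    rw [CircleTube.mem_source_iff]; exact hq
  have hP := contMDiffAt_coe_tube (g := g) f.boundaryTube hsrc
  have h2 : ContMDiff 𝓘(ℝ, EuclideanSpace ℝ (Fin 3)) 𝓘(ℝ, ℝ) ∞ (fun q : EuclideanSpace ℝ (Fin 3) => q 2) :=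
    (contDiff_piLp_apply (p := 2) (i := (2 : Fin 3))).contMDiff
  have hι : ContMDiffAt 𝓘(ℝ, EuclideanSpace ℝ (Fin 3)) ((𝓡 1).prod 𝓘(ℝ, EuclideanSpace ℝ (Fin 2))) ∞
      (fun q : EuclideanSpace ℝ (Fin 3) => ((circlePt (q 2), L q) :
        (sphere (0 : EuclideanSpace ℝ (Fin 2)) 1) × EuclideanSpace ℝ (Fin 2))) q :=
    ((contMDiff_circlePt.comp h2) q).prodMk L.contDiff.contMDiff.contMDiffAt
  have hcomp := hP.comp q hι
  exact hcomp

/-- The attaching-tube chart is `C^∞` (as a map of flat spaces) on the chart domain. [cite: Kosinski1993, VI §6] -/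
theorem contDiffAt_attachChart (q : EuclideanSpace ℝ (Fin 3)) (hq : ‖L q‖ < 1) :
    ContDiffAt ℝ ∞ (fun q : EuclideanSpace ℝ (Fin 3) => (((f.boundaryTube.toHomeo (circlePt (q 2), L q)).1).1 :
      EuclideanSpace ℝ (Fin 4))) q :=
  contMDiffAt_iff_contDiffAt.1 (contMDiffAt_attachChart f q hq)

/-! ## §2 The three columns at a core point `q₀ = (0, 0, t)` -/

variable (hL : ∀ (p : EuclideanSpace ℝ (Fin 3)) (i : Fin 2), L p i = p (Fin.castSucc i))
include hL

/-- The core points `(0, 0, t)` have zero fibre part. [folklore] -/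
theorem lam_single_two (t : ℝ) : L (EuclideanSpace.single (2 : Fin 3) t) = 0 := by
  ext i; rw [hL]; fin_cases i <;> simp

/-- **The angular column at the core is the ambient velocity of the attaching circle**:
`∂₂F (0, 0, t) = K'(t)`. [cite: Kosinski1993, VI §6] -/
theorem fderiv_attachChart_single_two (t : ℝ) :
    fderiv ℝ (fun q : EuclideanSpace ℝ (Fin 3) => (((f.boundaryTube.toHomeo (circlePt (q 2), L q)).1).1 :
        EuclideanSpace ℝ (Fin 4))) (EuclideanSpace.single (2 : Fin 3) t) (EuclideanSpace.single (2 : Fin 3) (1 : ℝ)) =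
      deriv (ambCurve g f.attachingCircle) t := by
  set F := fun q : EuclideanSpace ℝ (Fin 3) => (((f.boundaryTube.toHomeo (circlePt (q 2), L q)).1).1 :
    EuclideanSpace ℝ (Fin 4)) with hF
  set q₀ : EuclideanSpace ℝ (Fin 3) := EuclideanSpace.single (2 : Fin 3) t with hq₀
  have hq₀L : ‖L q₀‖ < 1 := by rw [hq₀, lam_single_two hL]; simp
  have hdiff : DifferentiableAt ℝ F q₀ := (contDiffAt_attachChart f q₀ hq₀L).differentiableAt (by simp)
  have h1 : HasDerivAt (fun s : ℝ => F (q₀ + s • EuclideanSpace.single (2 : Fin 3) (1 : ℝ)))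
      (fderiv ℝ F q₀ (EuclideanSpace.single (2 : Fin 3) (1 : ℝ))) 0 :=
    hdiff.hasFDerivAt.hasLineDerivAt _
  have hline : (fun s : ℝ => F (q₀ + s • EuclideanSpace.single (2 : Fin 3) (1 : ℝ))) =
      fun s => ambCurve g f.attachingCircle (t + s) := by
    funext s
    have e2 : (q₀ + s • EuclideanSpace.single (2 : Fin 3) (1 : ℝ)) 2 = t + s := by simp [hq₀]
    have eL : L (q₀ + s • EuclideanSpace.single (2 : Fin 3) (1 : ℝ)) = 0 := by
      ext i; rw [hL]; fin_cases i <;> simp [hq₀]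
    show ((f.boundaryTube.toHomeo (circlePt ((q₀ + s • EuclideanSpace.single (2 : Fin 3) (1 : ℝ)) 2),
      L (q₀ + s • EuclideanSpace.single (2 : Fin 3) (1 : ℝ)))).1).1 = _
    rw [e2, eL]
    show (f.toFun (depthLine (circlePt (t + s)) 0 0)).1 = _
    rw [depthLine_zero_zero]
    rfl
  have hKd : MDifferentiableAt (𝓡 1) (𝓡∂ 4) f.attachingCircle (circlePt (t + 0)) :=
    (isSmoothEmbedding_attachingCircle f).contMDiff.mdifferentiableAt (by simp)
  have h2 : HasDerivAt (fun s : ℝ => ambCurve g f.attachingCircle (t + s))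
      (deriv (ambCurve g f.attachingCircle) t) 0 := by
    have h := (hasDerivAt_ambCurve (g := g) hKd).differentiableAt.hasDerivAt
    rw [add_zero] at h
    exact HasDerivAt.comp_const_add t 0 (by rw [add_zero]; exact h)
  rw [hline] at h1
  exact h1.unique h2

/-- **The first fibre column at the core is the fibre derivative of the attaching tube on `e₀`**:
`∂₀F (0, 0, t) = ∂_v|₀ (f (depthLine (e^{2πit}) v 0)) (e₀)`. [cite: Kosinski1993, VI §6] -/
theorem fderiv_attachChart_single_zero (t : ℝ) :
    fderiv ℝ (fun q : EuclideanSpace ℝ (Fin 3) => (((f.boundaryTube.toHomeo (circlePt (q 2), L q)).1).1 :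
        EuclideanSpace ℝ (Fin 4))) (EuclideanSpace.single (2 : Fin 3) t) (EuclideanSpace.single (0 : Fin 3) (1 : ℝ)) =
      fderiv ℝ (fun v : EuclideanSpace ℝ (Fin 2) => (f.toFun (depthLine (circlePt t) v 0)).1) 0 planeE0 := by
  set F := fun q : EuclideanSpace ℝ (Fin 3) => (((f.boundaryTube.toHomeo (circlePt (q 2), L q)).1).1 :
    EuclideanSpace ℝ (Fin 4)) with hF
  set q₀ : EuclideanSpace ℝ (Fin 3) := EuclideanSpace.single (2 : Fin 3) t with hq₀
  have hq₀L : ‖L q₀‖ < 1 := by rw [hq₀, lam_single_two hL]; simp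
  have hdiff : DifferentiableAt ℝ F q₀ := (contDiffAt_attachChart f q₀ hq₀L).differentiableAt (by simp)
  have h1 : HasDerivAt (fun s : ℝ => F (q₀ + s • EuclideanSpace.single (0 : Fin 3) (1 : ℝ)))
      (fderiv ℝ F q₀ (EuclideanSpace.single (0 : Fin 3) (1 : ℝ))) 0 :=
    hdiff.hasFDerivAt.hasLineDerivAt _
  have hline : (fun s : ℝ => F (q₀ + s • EuclideanSpace.single (0 : Fin 3) (1 : ℝ))) =
      fun s => (f.toFun (depthLine (circlePt t) (s • planeE0) 0)).1 := by
    funext s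
    have e2 : (q₀ + s • EuclideanSpace.single (0 : Fin 3) (1 : ℝ)) 2 = t := by simp [hq₀]
    have eL : L (q₀ + s • EuclideanSpace.single (0 : Fin 3) (1 : ℝ)) = s • planeE0 := by
      ext i; rw [hL]; fin_cases i <;> simp [hq₀, planeE0]
    show ((f.boundaryTube.toHomeo (circlePt ((q₀ + s • EuclideanSpace.single (0 : Fin 3) (1 : ℝ)) 2),
      L (q₀ + s • EuclideanSpace.single (0 : Fin 3) (1 : ℝ)))).1).1 = _
    rw [e2, eL]
    rfl
  have hfib : DifferentiableAt ℝ (fun v : EuclideanSpace ℝ (Fin 2) => (f.toFun (depthLine (circlePt t) v 0)).1) 0 :=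
    (contDiffAt_attachingFibre f (circlePt t)).differentiableAt (by simp)
  have h2 : HasDerivAt (fun s : ℝ => (f.toFun (depthLine (circlePt t) (s • planeE0) 0)).1)
      (fderiv ℝ (fun v : EuclideanSpace ℝ (Fin 2) => (f.toFun (depthLine (circlePt t) v 0)).1) 0 planeE0) 0 := by
    have h := hfib.hasFDerivAt.hasLineDerivAt planeE0
    simp only [HasLineDerivAt, zero_add] at h
    exact h
  rw [hline] at h1
  exact h1.unique h2

/-- **The second fibre column at the core**: `∂₁F (0, 0, t) = ∂_v|₀ (f (depthLine (e^{2πit}) v 0)) (e₁)`.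
[cite: Kosinski1993, VI §6] -/
theorem fderiv_attachChart_single_one (t : ℝ) :
    fderiv ℝ (fun q : EuclideanSpace ℝ (Fin 3) => (((f.boundaryTube.toHomeo (circlePt (q 2), L q)).1).1 :
        EuclideanSpace ℝ (Fin 4))) (EuclideanSpace.single (2 : Fin 3) t) (EuclideanSpace.single (1 : Fin 3) (1 : ℝ)) =
      fderiv ℝ (fun v : EuclideanSpace ℝ (Fin 2) => (f.toFun (depthLine (circlePt t) v 0)).1) 0 planeE1 := by
  set F := fun q : EuclideanSpace ℝ (Fin 3) => (((f.boundaryTube.toHomeo (circlePt (q 2), L q)).1).1 :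
    EuclideanSpace ℝ (Fin 4)) with hF
  set q₀ : EuclideanSpace ℝ (Fin 3) := EuclideanSpace.single (2 : Fin 3) t with hq₀
  have hq₀L : ‖L q₀‖ < 1 := by rw [hq₀, lam_single_two hL]; simp
  have hdiff : DifferentiableAt ℝ F q₀ := (contDiffAt_attachChart f q₀ hq₀L).differentiableAt (by simp)
  have h1 : HasDerivAt (fun s : ℝ => F (q₀ + s • EuclideanSpace.single (1 : Fin 3) (1 : ℝ)))
      (fderiv ℝ F q₀ (EuclideanSpace.single (1 : Fin 3) (1 : ℝ))) 0 :=
    hdiff.hasFDerivAt.hasLineDerivAt _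
  have hline : (fun s : ℝ => F (q₀ + s • EuclideanSpace.single (1 : Fin 3) (1 : ℝ))) =
      fun s => (f.toFun (depthLine (circlePt t) (s • planeE1) 0)).1 := by
    funext s
    have e2 : (q₀ + s • EuclideanSpace.single (1 : Fin 3) (1 : ℝ)) 2 = t := by simp [hq₀]
    have eL : L (q₀ + s • EuclideanSpace.single (1 : Fin 3) (1 : ℝ)) = s • planeE1 := by
      ext i; rw [hL]; fin_cases i <;> simp [hq₀, planeE1]
    show ((f.boundaryTube.toHomeo (circlePt ((q₀ + s • EuclideanSpace.single (1 : Fin 3) (1 : ℝ)) 2),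
      L (q₀ + s • EuclideanSpace.single (1 : Fin 3) (1 : ℝ)))).1).1 = _
    rw [e2, eL]
    rfl
  have hfib : DifferentiableAt ℝ (fun v : EuclideanSpace ℝ (Fin 2) => (f.toFun (depthLine (circlePt t) v 0)).1) 0 :=
    (contDiffAt_attachingFibre f (circlePt t)).differentiableAt (by simp)
  have h2 : HasDerivAt (fun s : ℝ => (f.toFun (depthLine (circlePt t) (s • planeE1) 0)).1)
      (fderiv ℝ (fun v : EuclideanSpace ℝ (Fin 2) => (f.toFun (depthLine (circlePt t) v 0)).1) 0 planeE1) 0 := by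
    have h := hfib.hasFDerivAt.hasLineDerivAt planeE1
    simp only [HasLineDerivAt, zero_add] at h
    exact h
  rw [hline] at h1
  exact h1.unique h2

/-- The value of the chart at a core point is the point `K(t)` of the attaching circle. [folklore] -/
theorem attachChart_single_two (t : ℝ) :
    ((((f.boundaryTube.toHomeo (circlePt ((EuclideanSpace.single (2 : Fin 3) t) 2),
      L (EuclideanSpace.single (2 : Fin 3) t))).1).1 : EuclideanSpace ℝ (Fin 4))) = ambCurve g f.attachingCircle t := by
  rw [lam_single_two hL]
  have e2 : (EuclideanSpace.single (2 : Fin 3) t) 2 = t := by simp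
  rw [e2]
  show (f.toFun (depthLine (circlePt t) 0 0)).1 = _
  rw [depthLine_zero_zero]
  rfl

end Chart


/-! ## §3 The registered package -/

/-- **Sub-goal `helper_attachChart_columns` of stub `stub_T3_dualPresentation`** (T3 ▸ HB = `helper_Hgap_twisting`
▸ transfer step (R6c), tube side; wave 7, lead c5, worker H2): the value and the three columns of the
attaching-tube chart `q ↦ ((f♭ (e^{2πi q₂}, L q)).1).1` at a core point `(0, 0, t)` — the core point `K(t)`, the
fibre derivative of the attaching tube on `e₀`, `e₁`, and the ambient velocity `K'(t)`. [cite: Kosinski1993, VI §6] -/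
theorem helper_attachChart_columns : ∀ (g : ℕ) (f : Literature.Topology.FourManifolds.HandleAttachingMap 3 2 (Literature.Topology.FourManifolds.LefschetzBase.Base g)) (L : EuclideanSpace ℝ (Fin 3) →L[ℝ] EuclideanSpace ℝ (Fin 2)), (∀ (p : EuclideanSpace ℝ (Fin 3)) (i : Fin 2), L p i = p (Fin.castSucc i)) → ∀ (t : ℝ), ((((f.boundaryTube.toHomeo (Literature.Topology.FourManifolds.circlePt ((EuclideanSpace.single (2 : Fin 3) t) 2), L (EuclideanSpace.single (2 : Fin 3) t))).1).1 : EuclideanSpace ℝ (Fin 4))) = Literature.Topology.FourManifolds.LefschetzBase.ambCurve g f.attachingCircle t ∧ fderiv ℝ (fun q : EuclideanSpace ℝ (Fin 3) => (((f.boundaryTube.toHomeo (Literature.Topology.FourManifolds.circlePt (q 2), L q)).1).1 : EuclideanSpace ℝ (Fin 4))) (EuclideanSpace.single (2 : Fin 3) t) (EuclideanSpace.single (0 : Fin 3) (1 : ℝ)) = fderiv ℝ (fun v : EuclideanSpace ℝ (Fin 2) => (f.toFun (Literature.Topology.FourManifolds.depthLine (Literature.Topology.FourManifolds.circlePt t)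 v 0)).1) 0 Literature.Topology.FourManifolds.planeE0 ∧ fderiv ℝ (fun q : EuclideanSpace ℝ (Fin 3) => (((f.boundaryTube.toHomeo (Literature.Topology.FourManifolds.circlePt (q 2), L q)).1).1 : EuclideanSpace ℝ (Fin 4))) (EuclideanSpace.single (2 : Fin 3) t) (EuclideanSpace.single (1 : Fin 3) (1 : ℝ)) = fderiv ℝ (fun v : EuclideanSpace ℝ (Fin 2) => (f.toFun (Literature.Topology.FourManifolds.depthLine (Literature.Topology.FourManifolds.circlePt t) v 0)).1) 0 Literature.Topology.FourManifolds.planeE1 ∧ fderiv ℝ (fun q : EuclideanSpace ℝ (Fin 3) => (((f.boundaryTube.toHomeo (Literature.Topology.FourManifolds.circlePt (q 2), L q)).1).1 : EuclideanSpace ℝ (Fin 4))) (EuclideanSpace.single (2 : Fin 3) t) (EuclideanSpace.single (2 : Fin 3) (1 : ℝ)) = deriv (Literature.Topology.FourManifolds.LefschetzBase.ambCurve g f.attachingCircle) t :=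
  fun _ f _ hL t => ⟨attachChart_single_two f hL t, fderiv_attachChart_single_zero f hL t,
    fderiv_attachChart_single_one f hL t, fderiv_attachChart_single_two f hL t⟩

end Summit.SmoothPoincare4.SmoothPoincare4.Theorems.AcyclicBisectionExists.ModpBraidOrbits

end
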